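import Literature.Probability.RandomPlanarGeometry.HexParafermionProofs
import Literature.Probability.RandomPlanarGeometry.HexSAWLemma2
import HarnessLib

/-!
# Crux `SAWDevelopingMap.ObservableToSLE` (stmt-CriticalPhenomena-10472), line
`floor-ratio-restriction-bootstrap`: the Duminil-Copin–Smirnov arch-mass bound behind the anchor
stub `stub_shortChordLocality`

Landing target:
`Summits/CriticalPhenomena/SAWScalingLimit/Theorems/SAWDevelopingMapObservableToSLEShortChordLocalityArchMass.lean`
(`--supports stmt-CriticalPhenomena-10472`).

The anchor stub of the line is a statement about critical HALF-PLANE ARCHES of the hexagonal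
lattice: self-avoiding walks between two vertical boundary mid-edges `s`, `t` of the bottom zigzag
row of a vertex domain `Λ` lying in the rows above `s` (`stub_shortChordLocality`, reduced to
half-plane arch tightness in the sibling helper file).  This file transports the one a-priori bound
the tree has on such arches — Duminil-Copin–Smirnov's Lemma 2, `c_α A_{T,L} + B_{T,L} + c_ε E_{T,L}
= 1`, whence `A_{T,L}(x_c) ≤ 1/cos(3π/8)` (`stripA_le_of_lemma2`, `DuminilCopinSmirnov2012_lemma2_holds`,
stated in the coordinate model `HV` of `HexSAWLattice.lean` / `HexSAWStrip.lean`) — to the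
`HexVertex` / `HexMidEdgeSAW` vocabulary of the stub:

* `archMass_eq_sum_midWalks`: for a boundary mid-edge `a = {u, w₁}` (`u ∉ Λ ∋ w₁`) sent to the
  standard entrance `{wOut, hvOrigin}` by a chart `Φ : hexGraph ≃g hvGraph`, the critical mass
  `Z_Λ(a, {v,t}) = Σ_γ x_c^{ℓ(γ)}` is the sum of `x_c^ℓ` over the mid-edge walks of `Φ(Λ)` whose
  final dart lies on `{Φ v, Φ t}` (the coding bijection of `HexParafermionProofs.lean`, at spin `0`);
* the standard chart at a vertical floor mid-edge `s_x = {(x - e₁, 1), (x, 0)}` is the coordinate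
  map followed by the translation by `-x` (`floorChart_apply`, `floorChart_up`, `floorChart_down`);
  it maps the rows `≥ x₁` into Duminil-Copin–Smirnov strips `S_{T,L}` (`exists_map_subset_stripV`)
  and the other floor mid-edges `t_y = {(y - e₁, 1), (y, 0)}`, `y₁ = x₁`, `y ≠ x`, to `α ∖ {a}`
  (`isAlphaDart_of_mem_floorFilter`);
* **`sum_floorArchMass_le`**: for every finite `Λ` contained in the rows `≥ x₁` and every finite set
  `F` of cells `y ≠ x` of the row `x₁`, `Σ_{y ∈ F} Z_Λ(s_x, t_y) ≤ 1/cos(3π/8)`; in particular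
  (`floorArchMass_le`) every single arch mass `Z_Λ(s_x, t_y)` is `≤ 1/cos(3π/8)`, uniformly in
  `Λ` — the half-plane arch two-point function is finite (the "fixed span" sub-case of the anchor is
  the tail of this convergent series);
* (the dictionary between the geometric hypotheses of the stub — "`Λ` strictly above the line
  through `mid s`" — and "`Λ` in the rows `≥ x₁`" for vertical floor mid-edges is in the sibling
  helper file: `im_hexMidpoint_floorEdge`, `im_hexMidpoint_lt_im_hexCenter_iff`).
-/

noncomputable section

open scoped BigOperators Classical
open Literature.Probability.LatticeModels (HexVertex hexGraph hexCenter triEmbed triZeta Site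
  triZeta_re triZeta_im)
open Literature.Probability.RandomPlanarGeometry
open Literature.Probability.RandomPlanarGeometry.SAW
open Literature.Probability.RandomPlanarGeometry.SAW.HV

namespace Summit.CriticalPhenomena.SAWScalingLimit.Theorems.ObservableToSLE.FloorRatio

/-! ### Transport: the critical arch mass as a sum over coded mid-edge walks -/

/-- **`Z_Λ(a, z)` as a sum over the coordinate model.**  For a boundary mid-edge `a = {u, w₁}`
(`u ∉ Λ ∋ w₁`) mapped to the standard entrance by a chart `Φ : hexGraph ≃g hvGraph`
(`Φ u = wOut`, `Φ w₁ = hvOrigin`), the critical mass of the self-avoiding walks `a → {v, t}`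
(`v ∈ Λ`, `v ∼ t`) equals the sum of `x_c^{ℓ}` over the mid-edge walks of `Φ(Λ)` whose final dart
lies on `{Φ v, Φ t}`: the coding `γ ↦ wOut :: Φ(γ.verts) ++ [Φ e]` of `HexParafermionProofs` is a
length-preserving bijection. [cite: DuminilCopinSmirnov2012, §1–§2 (walks between mid-edges)] -/
theorem archMass_eq_sum_midWalks {Λ : Finset HexVertex} {a : Sym2 HexVertex}
    {u w₁ v t : HexVertex} {Φ : hexGraph ≃g hvGraph}
    (ha : a = s(u, w₁)) (hu : u ∉ Λ) (hw₁ : w₁ ∈ Λ) (huw : hexGraph.Adj u w₁)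
    (hΦu : Φ u = wOut) (hΦw : Φ w₁ = hvOrigin) (hvt : hexGraph.Adj v t) (hv : v ∈ Λ) :
    ∑ γ : HexMidEdgeSAW Λ a s(v, t), hexCriticalFugacity ^ γ.length =
      ∑ P ∈ (midWalks (Λ.map Φ.toEquiv.toEmbedding)).filter
          (fun P => finalDart P = (Φ v, Φ t) ∨ finalDart P = (Φ t, Φ v)),
        hexCriticalFugacity ^ mwLen P := by
  refine Finset.sum_bij (fun γ _ => if h : γ.verts = [] then [wOut, hvOrigin]
      else wOut :: (γ.verts.map Φ ++ [Φ (if γ.verts.getLast h = v then t else v)]))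
    (fun γ _ => ?_) (fun γ₁ _ γ₂ _ h => ?_) (fun P hP => ?_) (fun γ _ => ?_)
  · -- the code is a walk with the right final dart
    by_cases h : γ.verts = []
    · rw [dif_pos h, Finset.mem_filter, mem_midWalks_iff]
      refine ⟨isMidWalk_trivial _, ?_⟩
      rw [finalDart_trivial, ← hΦu, ← hΦw]
      have haz : s(u, w₁) = s(v, t) := ha ▸ γ.eq_of_nil h
      rcases Sym2.eq_iff.1 haz with ⟨h1, h2⟩ | ⟨h1, h2⟩
      · left; rw [h1, h2]
      · right; rw [h1, h2]
    · rw [dif_neg h, Finset.mem_filter, mem_midWalks_iff]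
      exact ⟨γ.isMidWalk_code Φ ha hu hΦu hΦw hvt h (γ.ite_spec hvt h),
        γ.finalDart_code h (γ.ite_spec hvt h)⟩
  · -- injectivity
    apply HexMidEdgeSAW.ext
    by_cases h₁ : γ₁.verts = [] <;> by_cases h₂ : γ₂.verts = []
    · rw [h₁, h₂]
    · rw [dif_pos h₁, dif_neg h₂] at h
      have := congrArg List.length h
      simp only [List.length_cons, List.length_append, List.length_map, List.length_nil] at this
      exact absurd (List.eq_nil_of_length_eq_zero (by omega)) h₂
    · rw [dif_neg h₁, dif_pos h₂] at h
      have := congrArg List.length h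
      simp only [List.length_cons, List.length_append, List.length_map, List.length_nil] at this
      exact absurd (List.eq_nil_of_length_eq_zero (by omega)) h₁
    · rw [dif_neg h₁, dif_neg h₂] at h
      have h' := congrArg List.dropLast (List.cons.inj h).2
      rw [List.dropLast_concat, List.dropLast_concat] at h'
      exact List.map_injective_iff.2 Φ.injective h'
  · -- surjectivity
    rw [Finset.mem_filter, mem_midWalks_iff] at hP
    obtain ⟨hPm, hfd⟩ := hP
    by_cases hP0 : P = [wOut, hvOrigin]
    · subst hP0
      have haz : a = s(v, t) := by
        rw [finalDart_trivial] at hfd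
        simp only [← hΦu, ← hΦw, Prod.mk.injEq, EmbeddingLike.apply_eq_iff_eq] at hfd
        rw [ha]
        rcases hfd with ⟨h1, h2⟩ | ⟨h1, h2⟩
        · rw [h1, h2]
        · rw [h1, h2, Sym2.eq_swap]
      have hfst : a ∈ hexDomainMidEdges Λ := by
        refine ⟨?_, w₁, by rw [ha]; exact Sym2.mem_mk_right u w₁, hw₁⟩
        rw [ha]; exact (SimpleGraph.mem_edgeSet hexGraph).2 huw
      refine ⟨⟨[], by simp, List.nodup_nil, List.isChain_nil, by simp, by simp, fun _ => haz,
        fun h => (h rfl).elim, hfst⟩, Finset.mem_univ _, ?_⟩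
      rw [dif_pos rfl]
    · obtain ⟨γ, hne, e, he, rfl⟩ :=
        exists_code_eq ha hu hw₁ huw hΦu hΦw hvt hv hPm hP0 hfd
      refine ⟨γ, Finset.mem_univ _, ?_⟩
      rw [dif_neg hne]
      congr 3
      rcases he with ⟨h1, h2⟩ | ⟨h1, h2⟩
      · rw [if_pos h1, h2]
      · rw [if_neg (by rw [h1]; exact hvt.ne.symm), h2]
  · -- the lengths agree
    by_cases h : γ.verts = []
    · rw [dif_pos h, mwLen_trivial, HexMidEdgeSAW.length, h, List.length_nil]
    · rw [dif_neg h, mwLen_cons_append, List.length_map, HexMidEdgeSAW.length]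

/-! ### The standard chart at a vertical floor mid-edge -/

/-- The standard chart at the cell `x`: the coordinate map `hvIso` followed by the translation by
`-x`; in coordinates `(y, i) ↦ (y₀ - x₀, y₁ - x₁, [i = 1])`. [folklore] -/
theorem floorChart_apply (x y : Site 2) (i : Fin 2) :
    (hvIso.trans (shift (-(x 0)) (-(x 1)))) (y, i) = (y 0 - x 0, y 1 - x 1, decide (i = 1)) :=
  rfl

/-- The standard chart sends the up-face `(x, 0)` (the inner endpoint of the vertical floor
mid-edge `s_x`) to the origin `hvOrigin`. [folklore] -/
theorem floorChart_up (x : Site 2) : (hvIso.trans (shift (-(x 0)) (-(x 1)))) (x, 0) = hvOrigin := by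
  rw [floorChart_apply, sub_self, sub_self]; rfl

/-- The standard chart sends the down-face `(x - e₁, 1)` below `(x, 0)` (the outer endpoint of the
vertical floor mid-edge `s_x`) to `wOut`. [folklore] -/
theorem floorChart_down (x : Site 2) :
    (hvIso.trans (shift (-(x 0)) (-(x 1)))) (x - Pi.single 1 1, 1) = wOut := by
  rw [floorChart_apply]
  simp [wOut]

/-- The vertical floor edge: the down-face `(y - e₁, 1)` is adjacent to the up-face `(y, 0)` above
it. [folklore] -/
theorem adj_floorEdge (y : Site 2) : hexGraph.Adj (y - Pi.single 1 1, 1) (y, 0) := by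
  rw [hexGraph_adj_iff_coord]
  simp

/-- The down-face `(y - e₁, 1)` lies in the row `y₁ - 1`, hence outside every vertex set contained
in the rows `≥ y₁`. [folklore] -/
theorem floorEdge_down_not_mem {Λ : Finset HexVertex} {x : Site 2}
    (hΛ : ∀ v ∈ Λ, x 1 ≤ v.1 1) {y : Site 2} (hy : y 1 = x 1) :
    (y - Pi.single 1 1, (1 : Fin 2)) ∉ Λ := by
  intro h
  have := hΛ _ h
  simp at this
  omega

/-! ### The rows above a floor fit into Duminil-Copin–Smirnov strips -/

/-- **Every finite piece of the upper half-lattice fits into a strip `S_{T,L}`.**  If `Λ` is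
contained in the rows `≥ x₁`, its image under the standard chart at `x` lies in `V(S_{T,L})` for
some `T ≥ 1` and `L`. [cite: DuminilCopinSmirnov2012, §3 (S_{T,L})] -/
theorem exists_map_subset_stripV (Λ : Finset HexVertex) (x : Site 2)
    (hΛ : ∀ v ∈ Λ, x 1 ≤ v.1 1) :
    ∃ T L : ℕ, 1 ≤ T ∧
      Λ.map (hvIso.trans (shift (-(x 0)) (-(x 1)))).toEquiv.toEmbedding ⊆ stripV T L := by
  refine ⟨Λ.sup (fun v => (v.1 1 - x 1).toNat) + 1, Λ.sup (fun v => (v.1 0 - x 0).natAbs),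
    Nat.le_add_left 1 _, fun w hw => ?_⟩
  obtain ⟨⟨y, i⟩, hy, rfl⟩ := Finset.mem_map.1 hw
  have h1 : x 1 ≤ y 1 := hΛ _ hy
  have hT : (y 1 - x 1).toNat ≤ Λ.sup (fun v => (v.1 1 - x 1).toNat) :=
    Finset.le_sup (f := fun v : HexVertex => (v.1 1 - x 1).toNat) hy
  have hL : (y 0 - x 0).natAbs ≤ Λ.sup (fun v => (v.1 0 - x 0).natAbs) :=
    Finset.le_sup (f := fun v : HexVertex => (v.1 0 - x 0).natAbs) hy
  have hT' : ((y 1 - x 1 : ℤ)) ≤ (Λ.sup (fun v => (v.1 1 - x 1).toNat) : ℕ) := by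
    have : ((y 1 - x 1).toNat : ℤ) = y 1 - x 1 := Int.toNat_of_nonneg (by omega)
    omega
  have hL' : |y 0 - x 0| ≤ ((Λ.sup (fun v => (v.1 0 - x 0).natAbs) : ℕ) : ℤ) := by
    rw [← Int.natCast_natAbs]; exact_mod_cast hL
  rw [abs_le] at hL'
  generalize (Λ.sup (fun v => (v.1 1 - x 1).toNat)) = A at *
  generalize (Λ.sup (fun v => (v.1 0 - x 0).natAbs)) = B at *
  fin_cases i
  · change ((y 0 - x 0, y 1 - x 1, false) : HV) ∈ stripV _ _
    rw [mem_stripV_iff]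
    simp only [lev_mk, bit_false]
    push_cast
    omega
  · change ((y 0 - x 0, y 1 - x 1, true) : HV) ∈ stripV _ _
    rw [mem_stripV_iff]
    simp only [lev_mk, bit_true]
    push_cast
    omega

/-! ### Floor exits are `α`-darts -/

/-- **The walks `s_x → t_y` exit through `α ∖ {a}`.**  Let `Λ` lie in the rows `≥ x₁`, let
`y₁ = x₁`, `y ≠ x`, and let `P` be a mid-edge walk of `Φ(Λ)` (standard chart `Φ` at `x`) whose
final dart lies on the image `{(y₀ - x₀, 0, false), (y₀ - x₀, -1, true)}` of the floor mid-edge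
`t_y = {(y - e₁, 1), (y, 0)}`.  Then the final dart points DOWN, from the level-`0` vertex
`(y₀ - x₀, 0, false)`: it is an `α`-dart with first coordinate `y₀ - x₀` (the reversed dart would
start below the floor, outside `Φ(Λ)`, and the trivial walk is excluded by `y ≠ x`).
[cite: DuminilCopinSmirnov2012, §3 (α)] -/
theorem isAlphaDart_of_mem_floorFilter {Λ : Finset HexVertex} {x y : Site 2}
    (hΛ : ∀ v ∈ Λ, x 1 ≤ v.1 1) (hy : y 1 = x 1) (hyx : y ≠ x) {P : List HV}
    (hP : IsMidWalk (Λ.map (hvIso.trans (shift (-(x 0)) (-(x 1)))).toEquiv.toEmbedding) P)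
    (hfd : finalDart P = ((y 0 - x 0, 0, false), (y 0 - x 0, -1, true)) ∨
      finalDart P = ((y 0 - x 0, -1, true), (y 0 - x 0, 0, false))) :
    IsAlphaDart (finalDart P) ∧ (finalDart P).1.1 = y 0 - x 0 := by
  rcases hfd with hfd | hfd
  · rw [hfd]; exact ⟨⟨rfl, rfl, rfl⟩, rfl⟩
  · exfalso
    rcases hP.trivial_or_exists with rfl | ⟨l, u, hl, rfl⟩
    · -- the trivial walk: `y₀ = x₀`, hence `y = x`
      rw [finalDart_trivial] at hfd
      have h0 : y 0 - x 0 = 0 := by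
        have := congrArg (fun d : HV × HV => d.1.1) hfd
        simpa [wOut] using this.symm
      exact hyx ((site_two_eq_iff y x).2 ⟨by omega, hy⟩)
    · -- a nontrivial walk: the last inner vertex lies in `Φ(Λ)`, at height `≥ 0`
      rw [finalDart_cons_append hl] at hfd
      have hlast : l.getLast hl ∈ Λ.map (hvIso.trans (shift (-(x 0)) (-(x 1)))).toEquiv.toEmbedding :=
        ((isMidWalk_cons_append_iff _ hl u).1 hP).2.2.2.1 _ (List.getLast_mem hl)
      obtain ⟨⟨z, j⟩, hz, hzl⟩ := Finset.mem_map.1 hlast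
      have h1 := hΛ _ hz
      have h2 := congrArg (fun d : HV × HV => d.1.2.1) hfd
      simp only at h2
      rw [← hzl] at h2
      change z 1 - x 1 = -1 at h2
      simp only at h1
      omega

/-! ### The Duminil-Copin–Smirnov bound on floor arch masses -/

/-- **Σ over floor exits of the critical arch masses is at most `1/cos(3π/8)`.**  Let `Λ` be a
finite vertex set contained in the rows `≥ x₁` of the hexagonal lattice (the closed upper
half-lattice whose bottom boundary mid-edges are the vertical edges `t_y = {(y - e₁, 1), (y, 0)}`,
`y₁ = x₁`), let `s_x = t_x` and let `F` be a finite set of cells `y ≠ x` of the row `x₁`.  Then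
`Σ_{y ∈ F} Z_Λ(s_x, t_y) ≤ 1/cos(3π/8)`, where `Z_Λ(s, t) = Σ_{γ ⊂ Λ : s → t} x_c^{ℓ(γ)}`:
under the standard chart the walks `s_x → t_y` become distinct walks `a → α ∖ {a}` of a strip
`S_{T,L} ⊇ Φ(Λ)`, so the sum is at most `A_{T,L}(x_c) ≤ 1/c_α` by Lemma 2 of Duminil-Copin–Smirnov
(`c_α A + B + c_ε E = 1`). [cite: DuminilCopinSmirnov2012, Lemma 2 and §3 ("A_T ≤ 1/c_α")] -/
theorem sum_floorArchMass_le (Λ : Finset HexVertex) (x : Site 2) (hΛ : ∀ v ∈ Λ, x 1 ≤ v.1 1)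
    (F : Finset (Site 2)) (hF : ∀ y ∈ F, y 1 = x 1 ∧ y ≠ x) :
    ∑ y ∈ F, ∑ γ : HexMidEdgeSAW Λ s((x - Pi.single 1 1, 1), (x, 0))
        s((y - Pi.single 1 1, 1), (y, 0)), hexCriticalFugacity ^ γ.length ≤
      (Real.cos (3 * Real.pi / 8))⁻¹ := by
  have h0 : 0 ≤ hexCriticalFugacity := hexCriticalFugacity_pos_lt_one.1.le
  set Φ : hexGraph ≃g hvGraph := hvIso.trans (shift (-(x 0)) (-(x 1))) with hΦ
  have hΦy : ∀ y : Site 2, Φ (y, 0) = (y 0 - x 0, y 1 - x 1, false) := fun y => rfl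
  have hΦy' : ∀ y : Site 2, Φ (y - Pi.single 1 1, 1) = (y 0 - x 0, y 1 - x 1 - 1, true) := by
    intro y
    rw [hΦ, floorChart_apply]
    simp only [Pi.sub_apply, Pi.single_eq_same, Fin.isValue, decide_true]
    refine Prod.ext ?_ (Prod.ext ?_ rfl)
    · simp
    · show y 1 - 1 - x 1 = y 1 - x 1 - 1
      ring
  -- the strip
  obtain ⟨T, L, hT, hsub⟩ := exists_map_subset_stripV Λ x hΛ
  -- remove the cells whose up-face is not in `Λ` (no walk ends there)
  by_cases hx0 : (x, (0 : Fin 2)) ∈ Λ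
  swap
  · -- `s_x` is not a mid-edge of `Ω(Λ)`: no walks at all
    have hempty : ∀ y : Site 2, IsEmpty (HexMidEdgeSAW Λ s((x - Pi.single 1 1, 1), (x, 0))
        s((y - Pi.single 1 1, 1), (y, 0))) := by
      intro y
      refine ⟨fun γ => ?_⟩
      obtain ⟨-, v, hv, hvΛ⟩ := γ.fst_mem
      rcases Sym2.mem_iff.1 hv with rfl | rfl
      · exact floorEdge_down_not_mem hΛ rfl hvΛ
      · exact hx0 hvΛ
    have : ∀ y ∈ F, ∑ γ : HexMidEdgeSAW Λ s((x - Pi.single 1 1, 1), (x, 0))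
        s((y - Pi.single 1 1, 1), (y, 0)), hexCriticalFugacity ^ γ.length = 0 := by
      intro y _
      haveI := hempty y
      exact Fintype.sum_empty _
    rw [Finset.sum_congr rfl this, Finset.sum_const_zero]
    exact inv_nonneg.2 (cos_three_pi_div_eight_pos).le
  -- the cells of `F` whose up-face is outside `Λ` contribute nothing
  set F' := F.filter (fun y => (y, (0 : Fin 2)) ∈ Λ) with hF'
  have hzero : ∀ y ∈ F, y ∉ F' → ∑ γ : HexMidEdgeSAW Λ s((x - Pi.single 1 1, 1), (x, 0))
      s((y - Pi.single 1 1, 1), (y, 0)), hexCriticalFugacity ^ γ.length = 0 := by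
    intro y hyF hyF'
    have hy0 : (y, (0 : Fin 2)) ∉ Λ := fun h => hyF' (Finset.mem_filter.2 ⟨hyF, h⟩)
    haveI : IsEmpty (HexMidEdgeSAW Λ s((x - Pi.single 1 1, 1), (x, 0))
        s((y - Pi.single 1 1, 1), (y, 0))) := by
      refine ⟨fun γ => ?_⟩
      by_cases hnil : γ.verts = []
      · -- the trivial walk forces `t_y = s_x`, i.e. `y = x`
        have heq := γ.eq_of_nil hnil
        have hmem : (y, (0 : Fin 2)) ∈ s((x - Pi.single 1 1, (1 : Fin 2)), (x, 0)) := by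
          rw [heq]; exact Sym2.mem_mk_right _ _
        rcases Sym2.mem_iff.1 hmem with h | h
        · exact (show (0 : Fin 2) ≠ 1 by decide) (congrArg Prod.snd h)
        · exact (hF y hyF).2 (congrArg Prod.fst h)
      · have hlast := γ.getLast_mem _ (List.getLast?_eq_some_getLast hnil)
        have hin := γ.subset _ (List.getLast_mem hnil)
        rcases Sym2.mem_iff.1 hlast with h | h
        · exact floorEdge_down_not_mem hΛ (hF y hyF).1 (h ▸ hin)
        · exact hy0 (h ▸ hin)
    exact Fintype.sum_empty _
  rw [← Finset.sum_subset (show F' ⊆ F from Finset.filter_subset _ _) hzero]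
  -- transport each arch mass to the coordinate model
  have hF'spec : ∀ y ∈ F', y ∈ F ∧ (y, (0 : Fin 2)) ∈ Λ := fun y hy => Finset.mem_filter.1 hy
  set S : Site 2 → Finset (List HV) := fun y =>
    (midWalks (Λ.map Φ.toEquiv.toEmbedding)).filter
      (fun P => finalDart P = (Φ (y, 0), Φ (y - Pi.single 1 1, 1)) ∨
        finalDart P = (Φ (y - Pi.single 1 1, 1), Φ (y, 0))) with hS
  have htrans : ∀ y ∈ F', ∑ γ : HexMidEdgeSAW Λ s((x - Pi.single 1 1, 1), (x, 0))
      s((y - Pi.single 1 1, 1), (y, 0)), hexCriticalFugacity ^ γ.length =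
        ∑ P ∈ S y, hexCriticalFugacity ^ mwLen P := by
    intro y hy
    have hy0 := (hF'spec y hy).2
    have e : s((y - Pi.single 1 1, (1 : Fin 2)), (y, (0 : Fin 2))) =
        s((y, (0 : Fin 2)), (y - Pi.single 1 1, (1 : Fin 2))) := Sym2.eq_swap
    rw [e]
    exact archMass_eq_sum_midWalks rfl (floorEdge_down_not_mem hΛ rfl) hx0 (adj_floorEdge x)
      (floorChart_down x) (floorChart_up x) (adj_floorEdge y).symm hy0
  rw [Finset.sum_congr rfl htrans]
  -- every coded walk is an `α`-walk of the strip, with first coordinate `y₀ - x₀`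
  have hkey : ∀ y ∈ F', ∀ P ∈ S y, IsAlphaDart (finalDart P) ∧ (finalDart P).1.1 = y 0 - x 0 ∧
      IsMidWalk (Λ.map Φ.toEquiv.toEmbedding) P := by
    intro y hy P hP
    have hyF := (hF'spec y hy).1
    obtain ⟨hPm, hfd⟩ := Finset.mem_filter.1 hP
    rw [mem_midWalks_iff] at hPm
    have hy1 := (hF y hyF).1
    rw [hΦy, hΦy', hy1, sub_self, zero_sub] at hfd
    exact ⟨(isAlphaDart_of_mem_floorFilter hΛ hy1 (hF y hyF).2 hPm hfd).1,
      (isAlphaDart_of_mem_floorFilter hΛ hy1 (hF y hyF).2 hPm hfd).2, hPm⟩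
  -- disjointness of the coded families
  have hdisj : (F' : Set (Site 2)).PairwiseDisjoint S := by
    intro y hy y' hy' hne
    rw [Function.onFun, Finset.disjoint_left]
    intro P hP hP'
    apply hne
    have h1 := (hkey y hy P hP).2.1
    have h2 := (hkey y' hy' P hP').2.1
    have hyF := (hF'spec y hy).1
    have hyF' := (hF'spec y' hy').1
    exact (site_two_eq_iff y y').2 ⟨by omega, by rw [(hF y hyF).1, (hF y' hyF').1]⟩
  rw [← Finset.sum_biUnion hdisj]
  -- comparison with `A_{T,L}`
  calc ∑ P ∈ F'.biUnion S, hexCriticalFugacity ^ mwLen P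
      ≤ stripA T L hexCriticalFugacity := by
        unfold stripA
        refine Finset.sum_le_sum_of_subset_of_nonneg ?_ fun _ _ _ => pow_nonneg h0 _
        intro P hP
        obtain ⟨y, hy, hPy⟩ := Finset.mem_biUnion.1 hP
        obtain ⟨hα, -, hPm⟩ := hkey y hy P hPy
        exact Finset.mem_filter.2 ⟨mem_midWalks_iff.2 (hPm.mono hsub), hα⟩
    _ ≤ (Real.cos (3 * Real.pi / 8))⁻¹ :=
        stripA_le_of_lemma2 DuminilCopinSmirnov2012_lemma2_holds hT L

/-- **A single critical arch mass is at most `1/cos(3π/8)`, uniformly in the domain.**  For `Λ`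
in the rows `≥ x₁` and a floor cell `y ≠ x` of the row `x₁`:
`Z_Λ(s_x, t_y) = Σ_{γ ⊂ Λ : s_x → t_y} x_c^{ℓ(γ)} ≤ 1/cos(3π/8)` — the half-plane arch two-point
function at `x_c` is finite. [cite: DuminilCopinSmirnov2012, Lemma 2 and §3 ("A_T ≤ 1/c_α")] -/
theorem floorArchMass_le (Λ : Finset HexVertex) (x y : Site 2) (hΛ : ∀ v ∈ Λ, x 1 ≤ v.1 1)
    (hy : y 1 = x 1) (hyx : y ≠ x) :
    ∑ γ : HexMidEdgeSAW Λ s((x - Pi.single 1 1, 1), (x, 0)) s((y - Pi.single 1 1, 1), (y, 0)),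
        hexCriticalFugacity ^ γ.length ≤ (Real.cos (3 * Real.pi / 8))⁻¹ := by
  have h := sum_floorArchMass_le Λ x hΛ {y} (fun y' hy' => by
    rw [Finset.mem_singleton] at hy'; subst hy'; exact ⟨hy, hyx⟩)
  rwa [Finset.sum_singleton] at h

/-! ### Registered form of the arch-mass bound (sub-goal of `stub_shortChordLocality`) -/

/-- **Registered sub-goal `stub_shortChordLocality_archMassBound`** (crux item
stmt-CriticalPhenomena-10472, line `floor-ratio-restriction-bootstrap`, anchor stub
`stub_shortChordLocality`): the Duminil-Copin–Smirnov bound `Σ_{y ∈ F} Z_Λ(s_x, t_y) ≤ 1/cos(3π/8)`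
on the critical floor arch masses of any finite `Λ` in the rows `≥ x₁` (`sum_floorArchMass_le`).
[cite: DuminilCopinSmirnov2012, Lemma 2 and §3 ("A_T ≤ 1/c_α")] -/
theorem stub_shortChordLocality_archMassBound :
    ∀ (Λ : Finset HexVertex) (x : Site 2), (∀ v ∈ Λ, x 1 ≤ v.1 1) →
      ∀ (F : Finset (Site 2)), (∀ y ∈ F, y 1 = x 1 ∧ y ≠ x) →
      ∑ y ∈ F, ∑ γ : HexMidEdgeSAW Λ s((x - Pi.single 1 1, 1), (x, 0))
        s((y - Pi.single 1 1, 1), (y, 0)), hexCriticalFugacity ^ γ.length ≤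
      (Real.cos (3 * Real.pi / 8))⁻¹ :=
  fun Λ x hΛ F hF => sum_floorArchMass_le Λ x hΛ F hF

end Summit.CriticalPhenomena.SAWScalingLimit.Theorems.ObservableToSLE.FloorRatio

end
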